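import Mathlib
import Summits.ValiantsHypothesis.ValiantsHypothesis.Theorems.LiouvilleSarnakAlignedTypeICharactersMod2nBilinearSieveGrowthFromCharSums
import HarnessLib

/-!
# Route LiouvilleSarnak — support `AlignedTypeI` (stmt-ValiantsHypothesis-21040), line `characters_mod_2n`:
# the truncated-logarithm congruence `t^{R+1} ∣ P(ta) + P(tb) − P(ta + tb + t²ab)` (heart of Postnikov's formula)

Sixth brick for `HS`.  With `P_R(x) = Σ_{m=1}^{R} (−1)^{m−1} (R!/m) x^m ∈ ℤ[x]` (`= R!·` the Taylor polynomial of `log(1 + x)`),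
the formal identity `log((1+x)(1+y)) = log(1+x) + log(1+y)` takes the integer form

  `t^{R+1} ∣ P_R(ta) + P_R(tb) − P_R(ta + tb + t²ab)`   for all integers `a, b, t`

(`two_variable_log_congruence`), proved WITHOUT bivariate polynomials by the `t`-substitution: for `φ(t) =
P(ta) + P(tb) − P(ta + tb + t²ab) ∈ ℤ[t]`, `(1 + x)P'(x) = R!(1 − (−x)^R)` gives
`(1 + ta)(1 + tb) φ'(t) = R!·[(a(1+tb) + b(1+ta))(−u)^R − a(1+tb)(−ta)^R − b(1+ta)(−tb)^R]`, `u = t(a + b + tab)`, which is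
divisible by `t^R`; as `(1+ta)(1+tb) ≡ 1 (mod t)` this gives `t^R ∣ φ'`, and with `φ(0) = 0`, `t^{R+1} ∣ φ`.
With `t = 2^τ`, `R = n + τ` (so `τ(R+1) > R + v₂(R!)`) this is the homomorphism property of the truncated `2`-adic
logarithm needed by `postnikov_formula_of_log` (the division by `R!` and the odd-part inverses are bookkeeping left to the
next file).

* `logPolyZ_deriv` — `(1 + X)·P' = R!(1 − (−X)^R)` in `ℤ[X]`;
* `X_pow_dvd_of_X_pow_dvd_one_add_X_mul` — `X^R ∣ (1 + Xv)f ⟹ X^R ∣ f`;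
* `two_variable_log_congruence` — ★ `t^{R+1} ∣ P_R(ta) + P_R(tb) − P_R(ta + tb + t²ab)`.

HONEST FRAMING. Helper lemmas only (unconditional); the leaf `AlignedTypeI` is NOT closed here; nothing bears on
`VP ≠ VNP` (NOT proved).
-/

set_option linter.dupNamespace false

noncomputable section

namespace Summit.ValiantsHypothesis.ValiantsHypothesis.Theorems.LiouvilleSarnak.AlignedTypeI.CharactersModTwoN

open Finset Polynomial

/-- **`(1 + X) P_R' = R!(1 − (−X)^R)`** for `P_R = Σ_{m<R} (−1)^{m}(R!/(m+1)) X^{m+1} ∈ ℤ[X]`. [folklore] -/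
theorem logPolyZ_deriv (R : ℕ) :
    (1 + X) * derivative (∑ m ∈ Finset.range R,
        C ((-1 : ℤ) ^ m * ((R.factorial / (m + 1) : ℕ) : ℤ)) * X ^ (m + 1)) =
      C ((R.factorial : ℕ) : ℤ) * (1 - (-X) ^ R) := by
  -- the derivative is `R! Σ_{m<R} (−X)^m`
  have hder : derivative (∑ m ∈ Finset.range R,
      C ((-1 : ℤ) ^ m * ((R.factorial / (m + 1) : ℕ) : ℤ)) * X ^ (m + 1)) =
      C ((R.factorial : ℕ) : ℤ) * ∑ m ∈ Finset.range R, (-X : ℤ[X]) ^ m := by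
    rw [derivative_sum, mul_sum]
    refine sum_congr rfl fun m hm => ?_
    have hmR : m + 1 ≤ R := mem_range.1 hm
    have hdvd : (m + 1) ∣ R.factorial := Nat.dvd_factorial (Nat.succ_pos m) hmR
    have hmul : ((R.factorial / (m + 1) : ℕ) : ℤ) * ((m + 1 : ℕ) : ℤ) = ((R.factorial : ℕ) : ℤ) := by
      exact_mod_cast Nat.div_mul_cancel hdvd
    rw [derivative_C_mul_X_pow, Nat.add_sub_cancel]
    have hc : (-1 : ℤ) ^ m * ((R.factorial / (m + 1) : ℕ) : ℤ) * ((m + 1 : ℕ) : ℤ) =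
        ((R.factorial : ℕ) : ℤ) * (-1) ^ m := by
      rw [mul_assoc, hmul]; ring
    have hc' : C ((-1 : ℤ) ^ m * ((R.factorial / (m + 1) : ℕ) : ℤ) * ((m + 1 : ℕ) : ℤ)) =
        C ((R.factorial : ℕ) : ℤ) * (-1 : ℤ[X]) ^ m := by
      rw [hc, C_mul, C_pow, C_neg, C_1]
    rw [hc', neg_pow (X : ℤ[X]) m]
    ring
  rw [hder]
  have hg := geom_sum_mul_neg (-X : ℤ[X]) R
  rw [sub_neg_eq_add] at hg
  calc (1 + X) * (C ((R.factorial : ℕ) : ℤ) * ∑ m ∈ Finset.range R, (-X : ℤ[X]) ^ m)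
      = C ((R.factorial : ℕ) : ℤ) * ((∑ m ∈ Finset.range R, (-X : ℤ[X]) ^ m) * (1 + X)) := by ring
    _ = C ((R.factorial : ℕ) : ℤ) * (1 - (-X) ^ R) := by rw [hg]

/-- `X^R ∣ (1 + X v) f` implies `X^R ∣ f` (in `ℤ[X]`; `1 + Xv` is a unit modulo `X`). [folklore] -/
theorem X_pow_dvd_of_X_pow_dvd_one_add_X_mul (v : ℤ[X]) :
    ∀ (R : ℕ) (f : ℤ[X]), X ^ R ∣ (1 + X * v) * f → X ^ R ∣ f := by
  intro R
  induction R with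
  | zero => intro f _; simp
  | succ R ih =>
    intro f hf
    have hR : X ^ R ∣ (1 + X * v) * f := (pow_dvd_pow X (Nat.le_succ R)).trans hf
    obtain ⟨g, hg⟩ := ih f hR
    -- `f = X^R g`; then `X^{R+1} ∣ X^R ((1 + Xv) g)` forces `X ∣ (1 + Xv) g`, hence `X ∣ g`
    rw [hg] at hf ⊢
    have h1 : X ^ R * X ∣ X ^ R * ((1 + X * v) * g) := by
      have e : (1 + X * v) * (X ^ R * g) = X ^ R * ((1 + X * v) * g) := by ring
      rw [← pow_succ, ← e]; exact hf
    have hX0 : (X : ℤ[X]) ^ R ≠ 0 := pow_ne_zero _ X_ne_zero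
    have h2 : X ∣ (1 + X * v) * g := (mul_dvd_mul_iff_left hX0).1 h1
    have h3 : X ∣ g := by
      have e : (1 + X * v) * g = g + X * (v * g) := by ring
      rw [e] at h2
      exact (dvd_add_left (dvd_mul_right X (v * g))).1 h2
    obtain ⟨w, hw⟩ := h3
    rw [hw, pow_succ]
    exact mul_dvd_mul_left _ (dvd_mul_right X w)

/-- If `X^R ∣ f'` and `f(0) = 0` then `X^{R+1} ∣ f` (in `ℤ[X]`). [folklore] -/
theorem X_pow_succ_dvd_of_derivative {f : ℤ[X]} {R : ℕ} (hd : X ^ R ∣ derivative f) (h0 : f.coeff 0 = 0) :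
    X ^ (R + 1) ∣ f := by
  rw [X_pow_dvd_iff] at hd ⊢
  intro d hdR
  rcases d with _ | d
  · exact h0
  · have h := hd d (by omega)
    rw [coeff_derivative] at h
    have hne : ((d : ℤ) + 1) ≠ 0 := by positivity
    exact (mul_eq_zero.1 h).resolve_right hne

/-- ★ **The two-variable logarithm congruence** (`log((1+x)(1+y)) = log(1+x) + log(1+y)`, truncated, in integers): with
`P_R(x) = Σ_{m<R} (−1)^m (R!/(m+1)) x^{m+1}`, for all integers `t, a, b`,
`t^{R+1} ∣ P_R(ta) + P_R(tb) − P_R(ta + tb + t²ab)`. [folklore] -/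
theorem two_variable_log_congruence (R : ℕ) (t a b : ℤ) :
    t ^ (R + 1) ∣
      (∑ m ∈ Finset.range R, (-1 : ℤ) ^ m * ((R.factorial / (m + 1) : ℕ) : ℤ) * (t * a) ^ (m + 1)) +
      (∑ m ∈ Finset.range R, (-1 : ℤ) ^ m * ((R.factorial / (m + 1) : ℕ) : ℤ) * (t * b) ^ (m + 1)) -
      (∑ m ∈ Finset.range R, (-1 : ℤ) ^ m * ((R.factorial / (m + 1) : ℕ) : ℤ) *
        (t * a + t * b + t ^ 2 * (a * b)) ^ (m + 1)) := by
  -- the polynomial `P` and the three substitutions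
  set P : ℤ[X] := ∑ m ∈ Finset.range R, C ((-1 : ℤ) ^ m * ((R.factorial / (m + 1) : ℕ) : ℤ)) * X ^ (m + 1) with hP
  set q₁ : ℤ[X] := C a * X with hq₁
  set q₂ : ℤ[X] := C b * X with hq₂
  set u : ℤ[X] := C a * X + C b * X + C (a * b) * X ^ 2 with hu
  set φ : ℤ[X] := P.comp q₁ + P.comp q₂ - P.comp u with hφ
  -- evaluation of `P` and of `φ`
  have hPeval : ∀ x : ℤ, P.eval x =
      ∑ m ∈ Finset.range R, (-1 : ℤ) ^ m * ((R.factorial / (m + 1) : ℕ) : ℤ) * x ^ (m + 1) := by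
    intro x
    rw [hP, eval_finsetSum]
    refine sum_congr rfl fun m _ => ?_
    rw [eval_mul, eval_C, eval_pow, eval_X]
  have hφeval : φ.eval t =
      (∑ m ∈ Finset.range R, (-1 : ℤ) ^ m * ((R.factorial / (m + 1) : ℕ) : ℤ) * (t * a) ^ (m + 1)) +
      (∑ m ∈ Finset.range R, (-1 : ℤ) ^ m * ((R.factorial / (m + 1) : ℕ) : ℤ) * (t * b) ^ (m + 1)) -
      (∑ m ∈ Finset.range R, (-1 : ℤ) ^ m * ((R.factorial / (m + 1) : ℕ) : ℤ) *
        (t * a + t * b + t ^ 2 * (a * b)) ^ (m + 1)) := by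
    rw [hφ, eval_sub, eval_add, eval_comp, eval_comp, eval_comp, hPeval, hPeval, hPeval]
    have e1 : q₁.eval t = t * a := by rw [hq₁, eval_mul, eval_C, eval_X]; ring
    have e2 : q₂.eval t = t * b := by rw [hq₂, eval_mul, eval_C, eval_X]; ring
    have e3 : u.eval t = t * a + t * b + t ^ 2 * (a * b) := by
      rw [hu]; simp only [eval_add, eval_mul, eval_C, eval_X, eval_pow]; ring
    rw [e1, e2, e3]
  rw [← hφeval]
  -- it suffices that `X^{R+1} ∣ φ`
  suffices hdiv : X ^ (R + 1) ∣ φ by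
    obtain ⟨ψ, hψ⟩ := hdiv
    refine ⟨ψ.eval t, ?_⟩
    rw [hψ, eval_mul, eval_pow, eval_X]
  -- the key identity `(1 + q₁)(1 + q₂) φ' = X^R G`
  have hD : (1 + X) * derivative P = C ((R.factorial : ℕ) : ℤ) * (1 - (-X) ^ R) := by
    rw [hP]; exact logPolyZ_deriv R
  have hkey : ∀ q : ℤ[X], (1 + q) * (derivative P).comp q = C ((R.factorial : ℕ) : ℤ) * (1 - (-q) ^ R) := by
    intro q
    have h := congrArg (fun p : ℤ[X] => p.comp q) hD
    simp only [mul_comp, add_comp, one_comp, X_comp, sub_comp, C_comp, pow_comp, neg_comp] at h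
    exact h
  have hφ' : derivative φ = C a * (derivative P).comp q₁ + C b * (derivative P).comp q₂ -
      (C a + C b + C (a * b) * (2 * X)) * (derivative P).comp u := by
    rw [hφ, derivative_sub, derivative_add, derivative_comp, derivative_comp, derivative_comp]
    have d1 : derivative q₁ = C a := by rw [hq₁, derivative_C_mul_X]
    have d2 : derivative q₂ = C b := by rw [hq₂, derivative_C_mul_X]
    have d3 : derivative u = C a + C b + C (a * b) * (2 * X) := by
      rw [hu, derivative_add, derivative_add, derivative_C_mul_X, derivative_C_mul_X, derivative_C_mul_X_pow]
      rw [show (2 : ℕ) - 1 = 1 from rfl, pow_one, Nat.cast_ofNat, C_mul, C_ofNat]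
      ring
    rw [d1, d2, d3]
  have h1u : (1 + q₁) * (1 + q₂) = 1 + u := by rw [hq₁, hq₂, hu, C_mul]; ring
  have hprod : (1 + q₁) * (1 + q₂) * derivative φ =
      X ^ R * (C ((R.factorial : ℕ) : ℤ) *
        ((C a * (1 + q₂) + C b * (1 + q₁)) * ((-1) ^ R * (C a + C b + C (a * b) * X) ^ R) -
          C a * (1 + q₂) * ((-1) ^ R * (C a) ^ R) - C b * (1 + q₁) * ((-1) ^ R * (C b) ^ R))) := by
    have k1 := hkey q₁
    have k2 := hkey q₂
    have k3 := hkey u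
    have hu' : C a + C b + C (a * b) * (2 * X) = C a * (1 + q₂) + C b * (1 + q₁) := by
      rw [hq₁, hq₂, C_mul]; ring
    rw [hφ', hu']
    have e1 : (-q₁) ^ R = (-1) ^ R * (C a) ^ R * X ^ R := by rw [hq₁, neg_pow, mul_pow]; ring
    have e2 : (-q₂) ^ R = (-1) ^ R * (C b) ^ R * X ^ R := by rw [hq₂, neg_pow, mul_pow]; ring
    have e3 : (-u) ^ R = (-1) ^ R * (C a + C b + C (a * b) * X) ^ R * X ^ R := by
      have : u = X * (C a + C b + C (a * b) * X) := by rw [hu]; ring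
      rw [this, neg_pow, mul_pow]; ring
    rw [e1] at k1
    rw [e2] at k2
    rw [e3] at k3
    linear_combination (C a * (1 + q₂)) * k1 + (C b * (1 + q₁)) * k2 -
      (C a * (1 + q₂) + C b * (1 + q₁)) * k3 -
      ((C a * (1 + q₂) + C b * (1 + q₁)) * (derivative P).comp u) * h1u
  -- `X^R ∣ φ'`
  have hXR : X ^ R ∣ derivative φ := by
    have hv : (1 + q₁) * (1 + q₂) = 1 + X * (C a + C b + C (a * b) * X) := by rw [hq₁, hq₂, C_mul]; ring
    refine X_pow_dvd_of_X_pow_dvd_one_add_X_mul (C a + C b + C (a * b) * X) R (derivative φ) ?_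
    rw [← hv, hprod]
    exact dvd_mul_right _ _
  -- `φ(0) = 0`
  have h0 : φ.coeff 0 = 0 := by
    rw [coeff_zero_eq_eval_zero, hφ, eval_sub, eval_add, eval_comp, eval_comp, eval_comp]
    have e1 : q₁.eval 0 = 0 := by rw [hq₁, eval_mul, eval_X, mul_zero]
    have e2 : q₂.eval 0 = 0 := by rw [hq₂, eval_mul, eval_X, mul_zero]
    have e3 : u.eval 0 = 0 := by rw [hu]; simp
    have eP : P.eval 0 = 0 := by rw [hPeval]; simp
    rw [e1, e2, e3, eP]; ring
  exact X_pow_succ_dvd_of_derivative hXR h0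

end Summit.ValiantsHypothesis.ValiantsHypothesis.Theorems.LiouvilleSarnak.AlignedTypeI.CharactersModTwoN
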